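/-
Copyright (c) 2026. All rights reserved.
Released under Apache 2.0 license as described in the file LICENSE.
-/
import Literature.NumberTheory.ComplexMultiplication.CMTypeRankMurtyBound
import Literature.NumberTheory.ComplexMultiplication.CMTypeDictionaryGroupLevel
import HarnessLib

/-!
# Murty's bound without faithfulness, for every CM field and — through the reflex — for every CM type:
# `(p − 1)² · v_p([K : ℚ]) ≤ p · rank(Φ)` (`Φ` primitive), `(p − 1)² · v_p([K* : ℚ]) ≤ p · rank(Φ)` (every `Φ`)

Companion of `CMTypeRankMurtyBound` (L. Mai, *Lower bounds for the ranks of CM types*, J. Number Theory 32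
(1989), §2 PROPOSITION 2, due to V. K. Murty, PROVED there in the integer form
`(p − 1)² · v_p(|G|) ≤ p · rank(Φ)` for a finite group `G` permuting the translates of `Φ ⊆ E` FAITHFULLY —
Mai's "`τ : G → GL(Y)` is an injective group homomorphism"), in the manner of the tree's
`ReflexDegreeRankBounds` (which carries Ribet's `log₂`-bound and Dodson's Thms. 1.4 / 1.12 through the reflex):

> "PROPOSITION 2.  Let `K/ℚ` be a Galois extension, with `G = Gal(K/ℚ)`, `(K, S)` be a simple CM type.  Then
> `rank(K, S) ≥ max_p {(p − 1)² α / p : p odd prime and p^α ∥ [K : ℚ]/2}`."  [Mai1989, §2, p. 195]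

§1 (abstract).  For ANY group `G` acting TRANSITIVELY on a finite set `E` and `Φ ⊆ E` whose translates separate
the points of `E` (the tree's primitivity, `isPrimitive_iff_forall_eq`), and every odd prime `p`:
**`(p − 1)² · v_p(|E|) ≤ p · rank_G(Φ)`** (`sq_mul_padicValNat_card_points_le_mul_typeRank`,
`…_of_isPrimitive`) — no faithfulness and no finiteness of `G`: the image `Ḡ` of `G` in `Sym(E)` has the same
translates and the same rank (the tree's change-of-group lemma `typeRank_preimage_eq`), permutes the translates
faithfully (an element fixing every translate moves no point), and `|E|` divides `|Ḡ|`; then Murty's bound for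
`Ḡ` (`sq_mul_padicValNat_card_le_mul_typeRank`).

§2 (number fields).
* `sq_mul_padicValNat_finrank_le_mul_cmTypeRank_of_isPrimitive` — for ANY number field `K` and a PRIMITIVE
  complex CM type `Φ` (`IsPrimitive (ℂ ≃+* ℂ) Φ.1 φ₀`, `Aut(ℂ)` acting transitively on `Hom(K, ℂ)`):
  `(p − 1)² · v_p([K : ℚ]) ≤ p · cmTypeRank Φ` — Mai's statement with "`K/ℚ` Galois" relaxed to what the printed
  proof uses ("`τ` injective", i.e. `(K, S)` simple); the normal case in the left-translation language is
  `Pohlmann1968/CMTypeRankMurtyBoundNumberField`.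
* `sq_mul_padicValNat_finrank_reflexField_le_mul_cmTypeRank` — for EVERY complex CM type `Φ` of `K`, read in a
  Galois number field `L` (`algValuedIn ι Φ`), with reflex field `K* = reflexField ℚ L Φ_L`:
  **`(p − 1)² · v_p([K* : ℚ]) ≤ p · cmTypeRank Φ`** — §1 for the reflex type `Φ* ⊆ Hom_ℚ(K*, L)`, which is
  always primitive (`isPrimitive_reflexType`), and `rank(Φ*) = rank(Φ)` (`typeRank_reflexType_eq`, Shimura §32.9).
* `sq_mul_padicValNat_finrank_le_mul_cmTypeRank_of_faithful` — for `L` Galois with `Gal(L/ℚ)` faithful on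
  `Hom_ℚ(K, L)` (`L` a Galois closure of `K`: Mai §1, "`L` the normal closure of `K`, with Galois group
  `G = Gal(L/ℚ)`") and `Φ` primitive: `(p − 1)² · v_p([L : ℚ]) ≤ p · cmTypeRank Φ` (Murty's count for
  `G = Gal(L/ℚ)`; Dodson 1987 Thm. 1.14 (2) prints the sharper Sylow form "`Rank(Φ) ≥ L(|G|)`,
  `G = Gal(Kᶜ/ℚ)`", not vendored here).

§3 (v2).  The same four dresses for DODSON'S `p`-SYLOW BOUND (Thm. 1.14 with `e_p = 2`, proved in
`CMTypeRankMurtyBound` §7 as `v_p(|G|) ≤ M(rank Φ − 2, p)`, `M` Minkowski's function): `v_p(|E|)`, `v_p([K : ℚ])`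
(primitive `Φ`), `v_p([K* : ℚ])` (every `Φ`), `v_p([L : ℚ])` (faithful `Gal(L/ℚ)`) are all `≤ M(rank Φ − 2, p)`.

§4 (v3).  The same for EVERY prime with Dodson's `e_p` (`e_2 = 1`, `e_p = 2` for `p` odd), through the tree's
Minkowski theorem (`CMTypeRankMurtyBound` §8): all four quantities are `≤ minkowskiExponent (rank Φ − e_p) p`.

Everything is a theorem; no definition, no named fact.  NOT here: Dodson's exact values `R(p, n)` and the sharpness
constructions; Mai's Prop. 3 (Fermat curves).

## References

* [Mai1989] L. Mai, *Lower bounds for the ranks of CM types*, J. Number Theory 32 (1989), §1 (p. 192), §2 Prop. 2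
  (pp. 195–196).
* [Dodson1987] B. Dodson, *On the Mumford–Tate group of an abelian variety with complex multiplication*,
  J. Algebra 111 (1987), Thm. 1.14 (pp. 55–56).
* [Shimura1998] G. Shimura, *Abelian Varieties with Complex Multiplication and Modular Functions*, §8.2 Prop. 26,
  §8.3 Prop. 28, §32.9.
* [Gordon1999HodgeAVSurvey] B. B. Gordon, *A survey of the Hodge conjecture for abelian varieties*, §9.4.4.
-/

set_option autoImplicit false

open NumberField

namespace Literature.NumberTheory.ComplexMultiplication

open Literature.AlgebraicGeometry
open Literature.AlgebraicGeometry.Motives (CMType)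

/-! ## §1 Murty's bound for a transitive action and a primitive type, without faithfulness -/

section Abstract

variable {G : Type*} [Group G] {E : Type*} [Fintype E] [MulAction G E]

/-- `v_p` is monotone along divisibility. [folklore] -/
private theorem padicValNat_mono_of_dvd {p a b : ℕ} [Fact p.Prime] (hb : b ≠ 0) (h : a ∣ b) :
    padicValNat p a ≤ padicValNat p b :=
  (padicValNat_dvd_iff_le hb).1 (pow_padicValNat_dvd.trans h)

omit [Fintype E] in
/-- Equal translate indicators at two points means: the one translate contains the one point iff the other
contains the other. [folklore] -/
private theorem smul_mem_iff_of_translateInd_eq {Φ : Set E} {g g' : G} {x x' : E}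
    (h : translateInd Φ g x = translateInd Φ g' x') : (g • x ∈ Φ ↔ g' • x' ∈ Φ) := by
  constructor
  · intro hk
    by_contra hk'
    rw [translateInd_of_mem hk, translateInd_of_not_mem hk'] at h
    exact one_ne_zero h
  · intro hk
    by_contra hk'
    rw [translateInd_of_not_mem hk', translateInd_of_mem hk] at h
    exact zero_ne_one h

/-- **Murty's bound for a transitive action, in terms of `|E|`, without faithfulness.**  If `G` (any group) acts
transitively on the finite set `E` and the translates of `Φ ⊆ E` separate the points of `E` ("`(K, S)` simple":
Mai §1, "By [7], `(K, S)` is simple if and only if `H = {g ∈ G : g S̃ = S̃}`"), then for every odd prime `p`: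
`(p − 1)² · v_p(|E|) ≤ p · rank(Φ)`.  Proof: the image `Ḡ ≤ Sym(E)` of `G` has the same translates, hence the same
rank; it permutes them faithfully ("`τ : G → GL(Y)` is an injective group homomorphism (can be checked directly)":
an element of `Ḡ` fixing every translate fixes every point); `|E| ∣ |Ḡ|` by transitivity; and Murty's count
`(p − 1)² · v_p(|Ḡ|) ≤ p · rank` (`sq_mul_padicValNat_card_le_mul_typeRank`). [cite: Mai1989, §2 Prop. 2 (and proof, pp. 195–196)] -/
theorem sq_mul_padicValNat_card_points_le_mul_typeRank [MulAction.IsPretransitive G E] (Φ : Set E)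
    (hsep : ∀ x y : E, (∀ g : G, g • x ∈ Φ ↔ g • y ∈ Φ) → x = y) {p : ℕ} (hp : p.Prime) (hp2 : p ≠ 2) :
    (p - 1) ^ 2 * padicValNat p (Fintype.card E) ≤ p * typeRank G Φ := by
  classical
  haveI : Fact p.Prime := ⟨hp⟩
  rcases isEmpty_or_nonempty E with hE | ⟨⟨x₀⟩⟩
  · rw [Fintype.card_eq_zero, padicValNat_zero_right, mul_zero]
    exact Nat.zero_le _
  set f : G →* Equiv.Perm E := MulAction.toPermHom G E with hf
  -- the image `Ḡ = f.range ≤ Sym(E)` acts on `E`; its element `f g` acts as `g`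
  have hact : ∀ (g : G) (x : E), (⟨f g, g, rfl⟩ : f.range) • x = g • x := fun g x => by
    rw [Subgroup.smul_def, Equiv.Perm.smul_def]
    simp [hf]
  haveI : MulAction.IsPretransitive f.range E := ⟨fun x y => by
    obtain ⟨g, hg⟩ := MulAction.exists_smul_eq G x y
    exact ⟨⟨f g, g, rfl⟩, by rw [hact, hg]⟩⟩
  -- same translates, same rank (change of group along the identity of `E`)
  have hrank : typeRank f.range Φ = typeRank G Φ :=
    typeRank_preimage_eq (G := G) (G' := f.range) Φ (Equiv.refl E)
      (fun r => by
        obtain ⟨_, g, rfl⟩ := r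
        exact ⟨g, fun x => by rw [Equiv.refl_apply, Equiv.refl_apply, hact]⟩)
      (fun g => ⟨⟨f g, g, rfl⟩, fun x => by rw [Equiv.refl_apply, Equiv.refl_apply, hact]⟩)
  -- `Ḡ` permutes the translates faithfully: an element fixing every translate fixes every point
  have hfaith : ∀ r : f.range, (∀ k : f.range, translateInd Φ (k * r) = translateInd Φ k) → r = 1 := by
    intro r hr
    obtain ⟨_, g, rfl⟩ := r
    have hfix : ∀ x : E, g • x = x := by
      intro x
      refine hsep (g • x) x fun k => ?_
      have h1 := congrFun (hr ⟨f k, k, rfl⟩) x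
      rw [translateInd_mul, hact] at h1
      have h2 := smul_mem_iff_of_translateInd_eq h1
      rwa [hact, hact] at h2
    refine Subtype.ext (Equiv.ext fun x => ?_)
    simp [hf, hfix x]
  -- `|E|` divides `|Ḡ|` (transitivity)
  have hdvd : Fintype.card E ∣ Fintype.card f.range := by
    have h1 : (MulAction.stabilizer f.range x₀).index * Nat.card (MulAction.stabilizer f.range x₀) =
        Nat.card f.range := Subgroup.index_mul_card _
    rw [MulAction.index_stabilizer_of_transitive] at h1
    have h2 : Nat.card E ∣ Nat.card f.range := Dvd.intro _ h1
    rwa [Nat.card_eq_fintype_card, Nat.card_eq_fintype_card] at h2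
  -- Murty's count for `Ḡ`
  have hM := sq_mul_padicValNat_card_le_mul_typeRank (G := f.range) Φ hfaith hp hp2
  rw [hrank] at hM
  calc (p - 1) ^ 2 * padicValNat p (Fintype.card E)
      ≤ (p - 1) ^ 2 * padicValNat p (Fintype.card f.range) :=
        Nat.mul_le_mul_left _ (padicValNat_mono_of_dvd Fintype.card_ne_zero hdvd)
    _ ≤ p * typeRank G Φ := hM

/-- **Murty's bound for the tree's `IsPrimitive`, in terms of `|E|`**: for a transitive action and a primitive
`(Φ, φh)` (Shimura §8.2 Prop. 26 "`H₁ = H'`" ⟺ the translates separate points, `isPrimitive_iff_forall_eq`),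
`(p − 1)² · v_p(|E|) ≤ p · rank(Φ)` for every odd prime `p` — with `E = Hom(K, ℂ)`, `|E| = [K : ℚ] = 2d`,
`p^α ∥ d`: `rank(K, S) ≥ (p − 1)² α / p`. [cite: Mai1989, §2 Prop. 2] [cite: Shimura1998, §8.2 Prop. 26] -/
theorem sq_mul_padicValNat_card_points_le_mul_typeRank_of_isPrimitive [MulAction.IsPretransitive G E]
    {Φ : Set E} {φh : E} (hprim : IsPrimitive G Φ φh) {p : ℕ} (hp : p.Prime) (hp2 : p ≠ 2) :
    (p - 1) ^ 2 * padicValNat p (Fintype.card E) ≤ p * typeRank G Φ :=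
  sq_mul_padicValNat_card_points_le_mul_typeRank Φ ((isPrimitive_iff_forall_eq Φ φh).1 hprim) hp hp2

end Abstract


/-! ## §2 Number fields: every CM field (primitive type), and every CM type through the reflex -/

section NumberField

variable {K : Type} [Field K] [NumberField K]

/-- **Mai 1989, Proposition 2 (Murty's bound) for an arbitrary number field `K` and a primitive type.**  For
`Φ` a complex CM type of `K` which is PRIMITIVE (`IsPrimitive (ℂ ≃+* ℂ) Φ.1 φ₀`: no strict subfield induces it;
"`(K, S)` simple") and every odd prime `p`: `(p − 1)² · v_p([K : ℚ]) ≤ p · rank(Φ)` — i.e.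
`rank(K, S) ≥ (p − 1)² α / p` for `p^α ∥ [K : ℚ]/2`.  Mai states it for `K/ℚ` Galois; the printed proof uses only
the injectivity of `τ : G → GL(Y)`, which is simplicity (§1 with `G = Aut(ℂ)` acting transitively on `Hom(K, ℂ)`,
the tree's `isPretransitive_ringEquiv_complex`). [cite: Mai1989, §2 Prop. 2]
[cite: Gordon1999HodgeAVSurvey, §9.4.4 (Proposition [B.72] Prop. 2)] -/
theorem sq_mul_padicValNat_finrank_le_mul_cmTypeRank_of_isPrimitive (Φ : CMType K) (φ₀ : K →+* ℂ)
    (hprim : IsPrimitive (ℂ ≃+* ℂ) Φ.1 φ₀) {p : ℕ} (hp : p.Prime) (hp2 : p ≠ 2) :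
    (p - 1) ^ 2 * padicValNat p (Module.finrank ℚ K) ≤ p * Pohlmann1968.cmTypeRank Φ := by
  haveI := Pohlmann1968.isPretransitive_ringEquiv_complex (K := K)
  have h := sq_mul_padicValNat_card_points_le_mul_typeRank_of_isPrimitive hprim hp hp2
  rwa [Embeddings.card K ℂ] at h

variable {L : Type} [Field L] [NumberField L] [IsGalois ℚ L]

/-- `|Hom_ℚ(K, L)| = [K : ℚ]` for `L/ℚ` normal receiving `K`. [folklore] -/
private theorem fintypeCard_algHom_eq_finrank (j : K →ₐ[ℚ] L) (ι : L →+* ℂ) :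
    Fintype.card (K →ₐ[ℚ] L) = Module.finrank ℚ K := by
  rw [← Nat.card_eq_fintype_card, card_algHom_eq_card_ringHom_of_normal j ι, Nat.card_eq_fintype_card,
    Embeddings.card]

/-- **Murty's bound through the reflex, for EVERY CM type: `(p − 1)² · v_p([K* : ℚ]) ≤ p · rank(Φ)`** for every
odd prime `p`, where `K* = reflexField ℚ L Φ_L` is the reflex field of the complex CM type `Φ` of `K` read
(`Φ_L = algValuedIn ι Φ`) in a Galois number field `L` receiving `K` — §1 for the reflex type
`Φ* ⊆ Hom_ℚ(K*, L)`, which is ALWAYS primitive (`isPrimitive_reflexType`: Shimura §8.3 / Streng Lemma 7.2), and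
`rank(Φ*) = rank(Φ)` (`typeRank_reflexType_eq`: Shimura §32.9 "`r(φ) = r(ψ)`"); no hypothesis on `Φ` or `K`.
[cite: Mai1989, §2 Prop. 2] [cite: Shimura1998, §32.9] -/
theorem sq_mul_padicValNat_finrank_reflexField_le_mul_cmTypeRank (φ : K →ₐ[ℚ] L) (ι : L →+* ℂ) (Φ : CMType K)
    {p : ℕ} (hp : p.Prime) (hp2 : p ≠ 2) :
    (p - 1) ^ 2 * padicValNat p (Module.finrank ℚ (reflexField ℚ L (algValuedIn ι Φ.1))) ≤
      p * Pohlmann1968.cmTypeRank Φ := by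
  have h := sq_mul_padicValNat_card_points_le_mul_typeRank_of_isPrimitive
    (isPrimitive_reflexType ℚ L (algValuedIn ι Φ.1) φ) hp hp2
  rw [typeRank_reflexType_eq ℚ L (algValuedIn ι Φ.1) φ, typeRank_algValuedIn_eq_cmTypeRank φ ι Φ] at h
  -- (the two `ℚ`-algebra structures on `K* ⊆ L` agree definitionally, not syntactically: no `rw` here)
  rw [← fintypeCard_algHom_eq_finrank (reflexField ℚ L (algValuedIn ι Φ.1)).val ι]
  exact h

/-- **Murty's bound with Mai's `G = Gal(L/ℚ)`, `L` a Galois closure of `K`** (§1: "`L` the normal closure of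
`K`, with Galois group `G = Gal(L/ℚ)`"; here: any Galois number field `L` receiving `K` on whose embeddings
`Gal(L/ℚ)` acts faithfully): for `Φ` primitive (read in `L`: `IsPrimitive (L ≃ₐ[ℚ] L) Φ_L φ`) and every odd
prime `p`, `(p − 1)² · v_p([L : ℚ]) ≤ p · rank(Φ)` — Murty's count for the faithful transitive `Gal(L/ℚ)` on
`Hom_ℚ(K, L)` (`sq_mul_padicValNat_card_le_mul_typeRank_of_isPrimitive`) and Dodson's `Rank(Φ)` over `Gal(L/ℚ)`
`= cmTypeRank Φ` (`typeRank_algValuedIn_eq_cmTypeRank`).  Dodson's Thm. 1.14 (2) is the sharper Sylow form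
"`Rank(Φ) ≥ L(|G|)`, `G = Gal(Kᶜ/ℚ)`" (not vendored). [cite: Mai1989, §2 Prop. 2]
[cite: Dodson1987, Thm. 1.14 (2) (pp. 55–56)] -/
theorem sq_mul_padicValNat_finrank_le_mul_cmTypeRank_of_faithful [FaithfulSMul (L ≃ₐ[ℚ] L) (K →ₐ[ℚ] L)]
    (φ : K →ₐ[ℚ] L) (ι : L →+* ℂ) (Φ : CMType K) (hprim : IsPrimitive (L ≃ₐ[ℚ] L) (algValuedIn ι Φ.1) φ)
    {p : ℕ} (hp : p.Prime) (hp2 : p ≠ 2) :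
    (p - 1) ^ 2 * padicValNat p (Module.finrank ℚ L) ≤ p * Pohlmann1968.cmTypeRank Φ := by
  have h := sq_mul_padicValNat_card_le_mul_typeRank_of_isPrimitive hprim hp hp2
  rwa [typeRank_algValuedIn_eq_cmTypeRank φ ι Φ, ← Nat.card_eq_fintype_card, IsGalois.card_aut_eq_finrank] at h

end NumberField

/-! ## §3 Dodson's `p`-Sylow bound (Thm. 1.14, `e_p = 2`) without faithfulness and for number fields

`CMTypeRankMurtyBound` §7 proves, for a CM type `Φ` whose translates a finite group permutes faithfully,
`v_p(|G|) ≤ M(rank Φ − 2, p)`, `M(d, p) = [d/(p−1)] + v_p([d/(p−1)]!)` (Minkowski's function).  As in §1–§2 this is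
carried to a transitive action in terms of `|E|`, to an arbitrary number field (primitive `Φ`), through the reflex to
every CM type, and to Mai's `G = Gal(L/ℚ)`. -/

section Sylow

variable {G : Type*} [Group G] {E : Type*} [Fintype E] [MulAction G E]

/-- **Dodson's Thm. 1.14 for a transitive action, in terms of `|E|`**: `G` any group acting transitively on the finite
`E`, `Φ` a CM type (`IsCMTypeWith ρ Φ`) whose translates separate points, `p` odd: `v_p(|E|) ≤ M(rank Φ − 2, p)`
(the image `Ḡ ≤ Sym(E)` carries the CM structure, has the same rank, permutes the translates faithfully, and
`|E| ∣ |Ḡ|`). [cite: Dodson1987, Thm. 1.14 (pp. 55–56)] -/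
theorem IsCMTypeWith.padicValNat_card_points_le_rank_sub_two_div_add [MulAction.IsPretransitive G E] {ρ : G}
    {Φ : Set E} (hΦ : IsCMTypeWith ρ Φ) (hsep : ∀ x y : E, (∀ g : G, g • x ∈ Φ ↔ g • y ∈ Φ) → x = y) {p : ℕ}
    (hp : p.Prime) (hp2 : p ≠ 2) :
    padicValNat p (Fintype.card E) ≤
      (typeRank G Φ - 2) / (p - 1) + padicValNat p ((typeRank G Φ - 2) / (p - 1)).factorial := by
  classical
  haveI : Fact p.Prime := ⟨hp⟩
  rcases isEmpty_or_nonempty E with hE | ⟨⟨x₀⟩⟩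
  · rw [Fintype.card_eq_zero, padicValNat_zero_right]
    exact Nat.zero_le _
  set f : G →* Equiv.Perm E := MulAction.toPermHom G E with hf
  have hact : ∀ (g : G) (x : E), (⟨f g, g, rfl⟩ : f.range) • x = g • x := fun g x => by
    rw [Subgroup.smul_def, Equiv.Perm.smul_def]
    simp [hf]
  haveI : MulAction.IsPretransitive f.range E := ⟨fun x y => by
    obtain ⟨g, hg⟩ := MulAction.exists_smul_eq G x y
    exact ⟨⟨f g, g, rfl⟩, by rw [hact, hg]⟩⟩
  have hrank : typeRank f.range Φ = typeRank G Φ :=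
    typeRank_preimage_eq (G := G) (G' := f.range) Φ (Equiv.refl E)
      (fun r => by
        obtain ⟨_, g, rfl⟩ := r
        exact ⟨g, fun x => by rw [Equiv.refl_apply, Equiv.refl_apply, hact]⟩)
      (fun g => ⟨⟨f g, g, rfl⟩, fun x => by rw [Equiv.refl_apply, Equiv.refl_apply, hact]⟩)
  -- the CM structure descends to `Ḡ`
  have hΦ' : IsCMTypeWith (⟨f ρ, ρ, rfl⟩ : f.range) Φ :=
    { mem_iff := fun x => by rw [hact]; exact hΦ.mem_iff x
      comm := fun r x => by
        obtain ⟨_, g, rfl⟩ := r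
        rw [hact, hact, hact, hact, hΦ.comm]
      invol := fun x => by rw [hact, hact, hΦ.invol] }
  have hfaith : ∀ r : f.range, (∀ k : f.range, translateInd Φ (k * r) = translateInd Φ k) → r = 1 := by
    intro r hr
    obtain ⟨_, g, rfl⟩ := r
    have hfix : ∀ x : E, g • x = x := by
      intro x
      refine hsep (g • x) x fun k => ?_
      have h1 := congrFun (hr ⟨f k, k, rfl⟩) x
      rw [translateInd_mul, hact] at h1
      have h2 := smul_mem_iff_of_translateInd_eq h1
      rwa [hact, hact] at h2
    refine Subtype.ext (Equiv.ext fun x => ?_)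
    simp [hf, hfix x]
  have hdvd : Fintype.card E ∣ Fintype.card f.range := by
    have h1 : (MulAction.stabilizer f.range x₀).index * Nat.card (MulAction.stabilizer f.range x₀) =
        Nat.card f.range := Subgroup.index_mul_card _
    rw [MulAction.index_stabilizer_of_transitive] at h1
    have h2 : Nat.card E ∣ Nat.card f.range := Dvd.intro _ h1
    rwa [Nat.card_eq_fintype_card, Nat.card_eq_fintype_card] at h2
  have hM := hΦ'.padicValNat_card_le_rank_sub_two_div_add hfaith hp hp2
  rw [hrank] at hM
  exact (padicValNat_mono_of_dvd Fintype.card_ne_zero hdvd).trans hM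

/-- **Dodson's Thm. 1.14 for the tree's `IsPrimitive`, in terms of `|E|`.** [cite: Dodson1987, Thm. 1.14 (pp. 55–56)]
[cite: Shimura1998, §8.2 Prop. 26] -/
theorem IsCMTypeWith.padicValNat_card_points_le_rank_sub_two_div_add_of_isPrimitive [MulAction.IsPretransitive G E]
    {ρ : G} {Φ : Set E} (hΦ : IsCMTypeWith ρ Φ) {φh : E} (hprim : IsPrimitive G Φ φh) {p : ℕ} (hp : p.Prime)
    (hp2 : p ≠ 2) :
    padicValNat p (Fintype.card E) ≤
      (typeRank G Φ - 2) / (p - 1) + padicValNat p ((typeRank G Φ - 2) / (p - 1)).factorial :=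
  hΦ.padicValNat_card_points_le_rank_sub_two_div_add ((isPrimitive_iff_forall_eq Φ φh).1 hprim) hp hp2

end Sylow

section SylowNumberField

variable {K : Type} [Field K] [NumberField K] [IsCMField K]

/-- **Dodson's Thm. 1.14 (2) for a CM field `K` and a primitive type: `v_p([K : ℚ]) ≤ M(rank Φ − 2, p)`** — "If `K`
is a given CM-field of degree `2n` … then for every primitive CM-type `Φ` on `K`, `Rank(Φ) ≥ L(|G|)`", read with
`|G| ≥ [K : ℚ]`-divisibility and Minkowski's `M`; `Aut(ℂ)` acting on `Hom(K, ℂ)` with `ρ` complex conjugation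
(`Pohlmann1968.isCMTypeWith_conj`). [cite: Dodson1987, Thm. 1.14 (2) (p. 56)] -/
theorem padicValNat_finrank_le_cmTypeRank_sub_two_div_add_of_isPrimitive (Φ : CMType K) (φ₀ : K →+* ℂ)
    (hprim : IsPrimitive (ℂ ≃+* ℂ) Φ.1 φ₀) {p : ℕ} (hp : p.Prime) (hp2 : p ≠ 2) :
    padicValNat p (Module.finrank ℚ K) ≤
      (Pohlmann1968.cmTypeRank Φ - 2) / (p - 1) +
        padicValNat p ((Pohlmann1968.cmTypeRank Φ - 2) / (p - 1)).factorial := by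
  haveI := Pohlmann1968.isPretransitive_ringEquiv_complex (K := K)
  have h := (Pohlmann1968.isCMTypeWith_conj Φ).padicValNat_card_points_le_rank_sub_two_div_add_of_isPrimitive
    hprim hp hp2
  rwa [Embeddings.card K ℂ] at h

variable {L : Type} [Field L] [NumberField L] [IsCMField L] [IsGalois ℚ L]

omit [IsCMField K] in
/-- **Dodson's Thm. 1.14 through the reflex, for EVERY CM type: `v_p([K* : ℚ]) ≤ M(rank Φ − 2, p)`** (`K*` the
reflex field of `Φ` read in a Galois CM field `L`; the reflex type is a primitive CM type of `K*` with the same rank).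
[cite: Dodson1987, Thm. 1.14 (pp. 55–56)] [cite: Shimura1998, §32.9] -/
theorem padicValNat_finrank_reflexField_le_cmTypeRank_sub_two_div_add (φ : K →ₐ[ℚ] L) (ι : L →+* ℂ)
    (Φ : CMType K) {p : ℕ} (hp : p.Prime) (hp2 : p ≠ 2) :
    padicValNat p (Module.finrank ℚ (reflexField ℚ L (algValuedIn ι Φ.1))) ≤
      (Pohlmann1968.cmTypeRank Φ - 2) / (p - 1) +
        padicValNat p ((Pohlmann1968.cmTypeRank Φ - 2) / (p - 1)).factorial := by
  have hW : IsCMTypeWith (conjGal : L ≃ₐ[ℚ] L) (reflexType ℚ L (algValuedIn ι Φ.1) φ) := by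
    have h := isCMTypeWith_conjGal_algValuedIn ι (reflexCMType ι Φ φ)
    rwa [algValuedIn_reflexCMType] at h
  have h := hW.padicValNat_card_points_le_rank_sub_two_div_add_of_isPrimitive
    (isPrimitive_reflexType ℚ L (algValuedIn ι Φ.1) φ) hp hp2
  rw [typeRank_reflexType_eq ℚ L (algValuedIn ι Φ.1) φ, typeRank_algValuedIn_eq_cmTypeRank φ ι Φ] at h
  rw [← fintypeCard_algHom_eq_finrank (reflexField ℚ L (algValuedIn ι Φ.1)).val ι]
  exact h

omit [IsCMField K] in
/-- **Dodson's Thm. 1.14 (2) with `G = Gal(L/ℚ)` faithful on `Hom_ℚ(K, L)`** (`L` a Galois closure of `K`, `Φ`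
primitive): `v_p([L : ℚ]) ≤ M(rank Φ − 2, p)` — "`G` is the group `Gal(Kᶜ/ℚ)` … `Rank(Φ) ≥ L(|G|)`" read through
Minkowski's theorem. [cite: Dodson1987, Thm. 1.14 (2) (p. 56)] [cite: Serre2007BoundsFiniteSubgroups, Lecture I Thm. 1 (i)] -/
theorem padicValNat_finrank_le_cmTypeRank_sub_two_div_add_of_faithful [FaithfulSMul (L ≃ₐ[ℚ] L) (K →ₐ[ℚ] L)]
    (φ : K →ₐ[ℚ] L) (ι : L →+* ℂ) (Φ : CMType K) (hprim : IsPrimitive (L ≃ₐ[ℚ] L) (algValuedIn ι Φ.1) φ)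
    {p : ℕ} (hp : p.Prime) (hp2 : p ≠ 2) :
    padicValNat p (Module.finrank ℚ L) ≤
      (Pohlmann1968.cmTypeRank Φ - 2) / (p - 1) +
        padicValNat p ((Pohlmann1968.cmTypeRank Φ - 2) / (p - 1)).factorial := by
  have h := (isCMTypeWith_conjGal_algValuedIn ι Φ).padicValNat_card_le_rank_sub_two_div_add_of_isPrimitive
    hprim hp hp2
  rwa [typeRank_algValuedIn_eq_cmTypeRank φ ι Φ, ← Nat.card_eq_fintype_card, IsGalois.card_aut_eq_finrank] at h

end SylowNumberField

/-! ## §4 Dodson's Thm. 1.14 for EVERY prime (`e_2 = 1`, `e_p = 2`), in the four dresses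

`CMTypeRankMurtyBound` §8 (v3) proves, through the tree's Minkowski theorem
(`GroupTheory.ArithmeticGroups.factorization_card_le_minkowskiExponent`), `v_p(|G|) ≤ M(rank Φ − e_p, p)` for every
prime `p` with Dodson's `e_p` ("`e_p = 2` if `p` is odd, `e_p = 1` if `p` is even"), `M = minkowskiExponent`.  Carried
over as in §1–§3. -/

section SylowAllPrimes

open Literature.GroupTheory

variable {G : Type*} [Group G] {E : Type*} [Fintype E] [MulAction G E]

/-- **Dodson's Thm. 1.14 for every prime, transitive action, in terms of `|E|`**: `G` any group acting transitively on
the finite `E`, `Φ` a CM type whose translates separate points, `p` any prime: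
`v_p(|E|) ≤ M(rank Φ − e_p, p)`, `e_p = 2` for `p` odd, `e_2 = 1`. [cite: Dodson1987, Thm. 1.14 (pp. 55–56)] -/
theorem IsCMTypeWith.padicValNat_card_points_le_minkowskiExponent_sub [MulAction.IsPretransitive G E] {ρ : G}
    {Φ : Set E} (hΦ : IsCMTypeWith ρ Φ) (hsep : ∀ x y : E, (∀ g : G, g • x ∈ Φ ↔ g • y ∈ Φ) → x = y) {p : ℕ}
    (hp : p.Prime) :
    padicValNat p (Fintype.card E) ≤
      ArithmeticGroups.minkowskiExponent (typeRank G Φ - if p = 2 then 1 else 2) p := by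
  classical
  haveI : Fact p.Prime := ⟨hp⟩
  rcases isEmpty_or_nonempty E with hE | ⟨⟨x₀⟩⟩
  · rw [Fintype.card_eq_zero, padicValNat_zero_right]
    exact Nat.zero_le _
  set f : G →* Equiv.Perm E := MulAction.toPermHom G E with hf
  have hact : ∀ (g : G) (x : E), (⟨f g, g, rfl⟩ : f.range) • x = g • x := fun g x => by
    rw [Subgroup.smul_def, Equiv.Perm.smul_def]
    simp [hf]
  haveI : MulAction.IsPretransitive f.range E := ⟨fun x y => by
    obtain ⟨g, hg⟩ := MulAction.exists_smul_eq G x y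
    exact ⟨⟨f g, g, rfl⟩, by rw [hact, hg]⟩⟩
  have hrank : typeRank f.range Φ = typeRank G Φ :=
    typeRank_preimage_eq (G := G) (G' := f.range) Φ (Equiv.refl E)
      (fun r => by
        obtain ⟨_, g, rfl⟩ := r
        exact ⟨g, fun x => by rw [Equiv.refl_apply, Equiv.refl_apply, hact]⟩)
      (fun g => ⟨⟨f g, g, rfl⟩, fun x => by rw [Equiv.refl_apply, Equiv.refl_apply, hact]⟩)
  have hΦ' : IsCMTypeWith (⟨f ρ, ρ, rfl⟩ : f.range) Φ :=
    { mem_iff := fun x => by rw [hact]; exact hΦ.mem_iff x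
      comm := fun r x => by
        obtain ⟨_, g, rfl⟩ := r
        rw [hact, hact, hact, hact, hΦ.comm]
      invol := fun x => by rw [hact, hact, hΦ.invol] }
  have hfaith : ∀ r : f.range, (∀ k : f.range, translateInd Φ (k * r) = translateInd Φ k) → r = 1 := by
    intro r hr
    obtain ⟨_, g, rfl⟩ := r
    have hfix : ∀ x : E, g • x = x := by
      intro x
      refine hsep (g • x) x fun k => ?_
      have h1 := congrFun (hr ⟨f k, k, rfl⟩) x
      rw [translateInd_mul, hact] at h1
      have h2 := smul_mem_iff_of_translateInd_eq h1
      rwa [hact, hact] at h2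
    refine Subtype.ext (Equiv.ext fun x => ?_)
    simp [hf, hfix x]
  have hdvd : Fintype.card E ∣ Fintype.card f.range := by
    have h1 : (MulAction.stabilizer f.range x₀).index * Nat.card (MulAction.stabilizer f.range x₀) =
        Nat.card f.range := Subgroup.index_mul_card _
    rw [MulAction.index_stabilizer_of_transitive] at h1
    have h2 : Nat.card E ∣ Nat.card f.range := Dvd.intro _ h1
    rwa [Nat.card_eq_fintype_card, Nat.card_eq_fintype_card] at h2
  have hM := hΦ'.padicValNat_card_le_minkowskiExponent_typeRank_sub hfaith hp
  rw [hrank] at hM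
  exact (padicValNat_mono_of_dvd Fintype.card_ne_zero hdvd).trans hM

/-- The same for the tree's `IsPrimitive`. [cite: Dodson1987, Thm. 1.14 (pp. 55–56)] [cite: Shimura1998, §8.2 Prop. 26] -/
theorem IsCMTypeWith.padicValNat_card_points_le_minkowskiExponent_sub_of_isPrimitive
    [MulAction.IsPretransitive G E] {ρ : G} {Φ : Set E} (hΦ : IsCMTypeWith ρ Φ) {φh : E}
    (hprim : IsPrimitive G Φ φh) {p : ℕ} (hp : p.Prime) :
    padicValNat p (Fintype.card E) ≤
      ArithmeticGroups.minkowskiExponent (typeRank G Φ - if p = 2 then 1 else 2) p :=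
  hΦ.padicValNat_card_points_le_minkowskiExponent_sub ((isPrimitive_iff_forall_eq Φ φh).1 hprim) hp

variable {K : Type} [Field K] [NumberField K] [IsCMField K]

/-- **Dodson's Thm. 1.14 (2) for a CM field and a primitive type, every prime**: `v_p([K : ℚ]) ≤ M(rank Φ − e_p, p)`.
[cite: Dodson1987, Thm. 1.14 (2) (p. 56)] -/
theorem padicValNat_finrank_le_minkowskiExponent_cmTypeRank_sub_of_isPrimitive (Φ : CMType K) (φ₀ : K →+* ℂ)
    (hprim : IsPrimitive (ℂ ≃+* ℂ) Φ.1 φ₀) {p : ℕ} (hp : p.Prime) :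
    padicValNat p (Module.finrank ℚ K) ≤
      ArithmeticGroups.minkowskiExponent (Pohlmann1968.cmTypeRank Φ - if p = 2 then 1 else 2) p := by
  haveI := Pohlmann1968.isPretransitive_ringEquiv_complex (K := K)
  have h := (Pohlmann1968.isCMTypeWith_conj Φ).padicValNat_card_points_le_minkowskiExponent_sub_of_isPrimitive
    hprim hp
  rwa [Embeddings.card K ℂ] at h

variable {L : Type} [Field L] [NumberField L] [IsCMField L] [IsGalois ℚ L]

omit [IsCMField K] in
/-- **Dodson's Thm. 1.14 through the reflex, EVERY CM type, every prime: `v_p([K* : ℚ]) ≤ M(rank Φ − e_p, p)`.**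
[cite: Dodson1987, Thm. 1.14 (pp. 55–56)] [cite: Shimura1998, §32.9] -/
theorem padicValNat_finrank_reflexField_le_minkowskiExponent_cmTypeRank_sub (φ : K →ₐ[ℚ] L) (ι : L →+* ℂ)
    (Φ : CMType K) {p : ℕ} (hp : p.Prime) :
    padicValNat p (Module.finrank ℚ (reflexField ℚ L (algValuedIn ι Φ.1))) ≤
      ArithmeticGroups.minkowskiExponent (Pohlmann1968.cmTypeRank Φ - if p = 2 then 1 else 2) p := by
  have hW : IsCMTypeWith (conjGal : L ≃ₐ[ℚ] L) (reflexType ℚ L (algValuedIn ι Φ.1) φ) := by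
    have h := isCMTypeWith_conjGal_algValuedIn ι (reflexCMType ι Φ φ)
    rwa [algValuedIn_reflexCMType] at h
  have h := hW.padicValNat_card_points_le_minkowskiExponent_sub_of_isPrimitive
    (isPrimitive_reflexType ℚ L (algValuedIn ι Φ.1) φ) hp
  rw [typeRank_reflexType_eq ℚ L (algValuedIn ι Φ.1) φ, typeRank_algValuedIn_eq_cmTypeRank φ ι Φ] at h
  rw [← fintypeCard_algHom_eq_finrank (reflexField ℚ L (algValuedIn ι Φ.1)).val ι]
  exact h

omit [IsCMField K] in
/-- **Dodson's Thm. 1.14 (2) with `G = Gal(L/ℚ)` faithful on `Hom_ℚ(K, L)`, every prime**: `v_p([L : ℚ]) ≤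
M(rank Φ − e_p, p)` for `Φ` primitive. [cite: Dodson1987, Thm. 1.14 (2) (p. 56)] -/
theorem padicValNat_finrank_le_minkowskiExponent_cmTypeRank_sub_of_faithful
    [FaithfulSMul (L ≃ₐ[ℚ] L) (K →ₐ[ℚ] L)] (φ : K →ₐ[ℚ] L) (ι : L →+* ℂ) (Φ : CMType K)
    (hprim : IsPrimitive (L ≃ₐ[ℚ] L) (algValuedIn ι Φ.1) φ) {p : ℕ} (hp : p.Prime) :
    padicValNat p (Module.finrank ℚ L) ≤
      ArithmeticGroups.minkowskiExponent (Pohlmann1968.cmTypeRank Φ - if p = 2 then 1 else 2) p := by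
  have h := (isCMTypeWith_conjGal_algValuedIn ι Φ).padicValNat_card_le_minkowskiExponent_typeRank_sub
    (fun g hg => eq_one_of_forall_translateInd_mul_eq hprim g hg) hp
  rwa [typeRank_algValuedIn_eq_cmTypeRank φ ι Φ, ← Nat.card_eq_fintype_card, IsGalois.card_aut_eq_finrank] at h

end SylowAllPrimes

end Literature.NumberTheory.ComplexMultiplication
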